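import Literature.NumberTheory.Automorphic.SatakeParameterGenericBoundFlathProofs
import Literature.NumberTheory.Automorphic.LocalComponentGenericCuspForms
import Literature.NumberTheory.Automorphic.SmoothedCuspFormGeneric
import HarnessLib

/-!
# Local components of cuspidal representations of `GL_n` are generic — the named fact discharged;
# Jacquet–Shalika's (5.1.3) from Cor. (2.5) alone

Topic `NumberTheory/Automorphic`; proof file (theorems only, no definition, no named fact). The two
halves of the printed proof of the genericity of cuspidal local components (Cogdell, *Analytic theory
of L-functions for GL_n* (2004), §1.2 p. 179, after Piatetski-Shapiro and Shalika (1974)) are in the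
tree:

* **(i)** the Fourier–Whittaker expansion in the form *a smoothed `L²` cusp form whose global
  Whittaker coefficient vanishes identically is zero* (Shalika (1974), Thm. 5.9; Cogdell (2004),
  Thm. 1.1 and its Corollary: `exists_whittakerCoeff_invQuot_smoothedForm_ne_zero_of_one_le` of
  `SmoothedCuspFormGeneric`, through the mean-square mirabolic tower `CuspidalTowerGeneric` /
  `WhittakerTowerBridge`);
* **(ii)** *a global Whittaker functional restricts to local Whittaker functionals on the local
  components* (`isGeneric_of_hasLocalComponentAt_of_zeroDetection` of `LocalComponentGeneric`).

This leaf assembles them: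

* `Shalika1974_isGeneric_of_hasLocalComponentAt_holds` — **the named fact
  `Shalika1974_isGeneric_of_hasLocalComponentAt` of `SatakeParameterGenericBound` holds in every
  rank** (`n = 0` being `Shalika1974_isGeneric_of_hasLocalComponentAt_of_le_one`);
* `norm_satakeParameter_le_sqrt_of_normLt` — consequently Jacquet–Shalika's bound (5.1.3)
  (`norm_satakeParameter_le_sqrt` of `AutomorphicLFunctionProofs`) follows from the single remaining
  named input, Jacquet–Shalika's local Cor. (2.5) (`JacquetShalika1981_norm_lt_sqrt_of_isGeneric`)
  for the completions `K_v` (`norm_satakeParameter_le_sqrt_of_isGeneric'` of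
  `SatakeParameterGenericBoundFlathProofs` with `exists_hasLocalComponentAt_holds`; compare
  `norm_satakeParameter_le_sqrt_of_isGeneric_of_normLt` of `SatakeParameterBoundAssembly`).

## References

* J. W. Cogdell, *Analytic theory of L-functions for GL_n*, in: J. Bernstein, S. Gelbart (eds.),
  *An Introduction to the Langlands Program* (2004), §1.1 Thm. 1.1 (p. 176), §1.2 (p. 179)
  [CogdellAnalyticTheory2004].
* J. A. Shalika, *The multiplicity one theorem for GL_n*, Ann. of Math. 100 (1974), §5, Thm. 5.9
  [Shalika1974].
* H. Jacquet, J. A. Shalika, *On Euler products and the classification of automorphic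
  representations I*, Amer. J. Math. 103 (1981), (5.1.3) p. 554, Cor. (2.5) p. 515, Remark (2.6)(3)
  [JacquetShalikaAJM1981].
-/

noncomputable section

open scoped MatrixGroups
open NumberField IsDedekindDomain MeasureTheory

namespace Literature.NumberTheory.Automorphic

section Holds

variable {n : ℕ} {K : Type} [Field K] [NumberField K]
  {μ : Measure (AdelicGroupData.gl n K).automorphicQuotient}
  [(AdelicGroupData.gl n K).IsAutomorphicMeasure μ]

/-- **Local components of cusp forms on `GL_n` are generic** — the named fact
`Shalika1974_isGeneric_of_hasLocalComponentAt` of `SatakeParameterGenericBound`, now a theorem in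
every rank: every irreducible admissible local component `ρ` at a finite place `v` of a cuspidal
automorphic representation `Π ≤ L²_cusp(GL_n(𝔸_K) ⧸ A_G GL_n(K))` is generic for the (non-trivial,
continuous) local component `ψ_v` of Tate's character (`adicComponent_adeleAddChar_ne_one`). For
`1 ≤ n`: the non-zero smoothed `L²` cusp forms are detected by their global Whittaker coefficients
(`exists_whittakerCoeff_invQuot_smoothedForm_ne_zero_of_one_le`, the Fourier–Whittaker expansion,
Cogdell (2004), Thm. 1.1, for the Borel structures and the Haar measure of `N_n(𝔸_K)`), so the
local Whittaker functional of `isGeneric_of_hasLocalComponentAt_of_zeroDetection` (Cogdell (2004),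
§1.2: "any Whittaker functional `Λ` on `V_π` determines a family of local Whittaker functionals
`Λ_v`") is non-zero; `n = 0` is `Shalika1974_isGeneric_of_hasLocalComponentAt_of_le_one`.
[cite: CogdellAnalyticTheory2004, §1.2 p. 179 (Thm. 1.1 p. 176)] [cite: Shalika1974, §5 Thm. 5.9] -/
theorem Shalika1974_isGeneric_of_hasLocalComponentAt_holds :
    Shalika1974_isGeneric_of_hasLocalComponentAt (n := n) (K := K) (μ := μ) := by
  rcases Nat.lt_or_ge n 1 with hn | hn
  · exact Shalika1974_isGeneric_of_hasLocalComponentAt_of_le_one (by omega)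
  intro P v V _ _ ρ _ hadm hloc
  letI : MeasurableSpace (AdeleRing (𝓞 K) K) := borel _
  haveI : BorelSpace (AdeleRing (𝓞 K) K) := ⟨rfl⟩
  letI : MeasurableSpace (GL (Fin n) (AdeleRing (𝓞 K) K)) := borel _
  haveI : BorelSpace (GL (Fin n) (AdeleRing (𝓞 K) K)) := ⟨rfl⟩
  refine ⟨(adeleAddChar K).adicComponent v,
    (isGlobalAddChar_adeleAddChar K).isContinuousNontrivial_adicComponent
      (adicComponent_adeleAddChar_ne_one v), ?_⟩
  exact isGeneric_of_hasLocalComponentAt_of_zeroDetection (μ := μ) Measure.haar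
    (fun η hη hηs F hF hne =>
      exists_whittakerCoeff_invQuot_smoothedForm_ne_zero_of_one_le hn hη hηs hF hne _)
    P v ρ hadm.isSmooth hloc

/-- **Jacquet–Shalika's (5.1.3) from Cor. (2.5) alone.** With genericity of the local components
discharged (`Shalika1974_isGeneric_of_hasLocalComponentAt_holds`) and Flath's inputs proved
(`exists_hasLocalComponentAt_holds`, `Flath1979_isSatakeParameter_of_hasLocalComponentAt_holds`),
the named fact `norm_satakeParameter_le_sqrt` of `AutomorphicLFunctionProofs` — `|a| ≤ q_v^{1/2}`
for every Hecke–Satake parameter of a cuspidal automorphic representation of `GL_n(𝔸_K)` at an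
unramified place — follows from Jacquet–Shalika's local Cor. (2.5) for the fields `K_v` (the named
fact `JacquetShalika1981_norm_lt_sqrt_of_isGeneric`; proved in the tree for `n ≤ 2`,
`JacquetShalika1981_norm_lt_sqrt_of_isGeneric_of_le_one` and
`JacquetShalika1981_norm_lt_sqrt_of_isGeneric_two`), exactly as indicated in Remark (2.6)(3) of the
source. [cite: JacquetShalikaAJM1981, (5.1.3) p. 554, Cor. (2.5) p. 515, Remark (2.6)(3)] -/
theorem norm_satakeParameter_le_sqrt_of_normLt
    (hB : ∀ (v : HeightOneSpectrum (𝓞 K)) {V : Type} [AddCommGroup V] [Module ℂ V]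
      (ρ : Representation ℂ (GL (Fin n) (v.adicCompletion K)) V),
      JacquetShalika1981_norm_lt_sqrt_of_isGeneric ρ) :
    norm_satakeParameter_le_sqrt (n := n) (K := K) (μ := μ) :=
  norm_satakeParameter_le_sqrt_of_isGeneric' exists_hasLocalComponentAt_holds
    Shalika1974_isGeneric_of_hasLocalComponentAt_holds
    hB

end Holds

end Literature.NumberTheory.Automorphic
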